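import Literature.AlgebraicGeometry.ComplexMultiplication.CyclotomicFermatCMTypesKoblitzEllipticLevelsForty
import HarnessLib

/-!
# Koblitz's list of elliptic Fermat levels (Bauer–Coste–Itzykson–Ruelle §3.4 [kob]): the kernel census COMPLETED UP TO THE TOP OF THE LIST —
# for `3 ≤ n₀ ≤ 60` a primitive triple with `H_{r,s,t}` a group exists iff `n₀ ∈ {3, 4, 6, 7, 8, 12, 15, 16, 18, 20, 21, 22, 24, 30, 39, 40, 48, 60}`

Layer `Literature/AlgebraicGeometry/ComplexMultiplication`; sequel of `CyclotomicFermatCMTypesKoblitzEllipticLevels` (witnesses at the eighteen listed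
levels; census `n₀ ≤ 30`) and `CyclotomicFermatCMTypesKoblitzEllipticLevelsForty` (census `n₀ ≤ 40`).  THIS FILE: the negative side at every level
`41 ≤ n ≤ 59`, `n ≠ 48`, and the census iff for `3 ≤ n ≤ 60` with EXACTLY the printed set.  The kernel cost is cut by a CHEAP NECESSARY CONDITION
evaluated first: if `H` is closed under multiplication then in particular `h ∈ H ⟹ h² ∈ H`, a test on the defining predicate of `H_{r,s,t}` that needs no
enumeration of `H` (§0 `not_exists_primitive_group_triple_of_sq`); the full closure test is then only run on the few survivors (`decide +kernel`,
≈ `3–8 s` per level instead of `40–110 s`).  THEOREMS ONLY (no definition, no named fact, no `sorry`).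

THE SOURCE.  M. Bauer, A. Coste, C. Itzykson, P. Ruelle, J. Geom. Phys. **22** (1997), §3.4 p. 14 (held `paper:arxiv-hep-th_9604104`): «Koblitz has
solved the more difficult question to list all lattices `L_{r,s,t}` that have a maximal splitting in elliptic curves.  Setting `gcd(r,s,t) = n/n₀` as
above, he finds that no `L_{r,s,t}` is isogenous to a product of elliptic factors unless `n₀` belongs to the following set `{3, 4, 6, 7, 8, 12, 15, 16, 18, 20, 21, 22, 24, 30, 39, 40, 48, 60}` [kob]» ([kob] =
N. Koblitz, Duke Math. J. 45 (1978) 87–99, NOT held; acq-13294).  The census below VERIFIES the printed set in the kernel for every `n₀ ≤ 60`, i.e.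
over the whole range of the list; «no `n₀ > 60`» remains Koblitz's theorem (CITE).

READING (as in the prequels).  Normalised representative `(r, s, −r−s)`, `r, s ≠ 0`, `⟨r⟩ + ⟨s⟩ < n` (so `1 ∈ H`), primitive iff `gcd(r, s, n) = 1`;
«splits into elliptic curves» ⟺ `H` closed under multiplication (`exists_isIsogeny_pow_elliptic_fermat_iff_forall_mul_mem`).

## What is proved

* §0 `not_exists_primitive_group_triple_of_sq` (any `n`): the census statement follows from its variant with the extra conjunct «`h ∈ H ⟹ h² ∈ H`»
  (stated on the defining predicate `gcd(⟨h⟩, n) = 1 ∧ ⟨hr⟩ + ⟨hs⟩ + ⟨ht⟩ = n`).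
* §1 `not_exists_primitive_group_triple_fortyOne … _fiftyNine` (`n = 41,…,47, 49,…,59`): NO primitive normalised triple has `H` a group (kernel).
* §2 **`exists_primitive_group_triple_iff_of_le_sixty`** — for `3 ≤ n ≤ 60`: such a triple exists iff `n ∈ {3, 4, 6, 7, 8, 12, 15, 16, 18, 20, 21, 22, 24, 30, 39, 40, 48, 60}`
  (THE PRINTED SET, verbatim); **`mem_koblitzList_of_exists_isIsogeny_pow_elliptic_of_le_sixty`** (on abelian varieties).

## Honest column

(a) The census is exhaustive for `n₀ ≤ 60` only; Koblitz's theorem for `n₀ > 60` is CITE [kob] (not held).  (b) As before, «elliptic» is read on the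
K–R factor TYPES (every realisation), not on a constructed `J(F_n)`.  The Hodge conjecture is not proved and nothing here bears on it.
-/

noncomputable section

open NumberField

namespace Literature.AlgebraicGeometry.ComplexMultiplication

open CategoryTheory CategoryTheory.Limits
open Literature.AlgebraicGeometry.Motives (CMType AbelianVariety)
open Literature.AlgebraicGeometry.Motives.AbelianVariety
open Literature.NumberTheory.ComplexMultiplication
open Literature.AlgebraicGeometry.HodgeTheory
open Literature.AlgebraicGeometry.Pohlmann1968 Literature.AlgebraicGeometry.Pohlmann1968.Cyclotomic
open CyclotomicCMTypeResidueSets (IsCMResidueSet unitResidues residueSet residueSet_cmTypeOfResidues isCMResidueSet_residueSet)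

namespace CyclotomicFermatCMType

/-! ## §0 The cheap necessary condition `h ∈ H ⟹ h² ∈ H` -/

section Filter

variable {n : ℕ} [NeZero n]

/-- If `H_{r,s,t}` is closed under multiplication then `h ∈ H ⟹ h·h ∈ H`; stated on the defining predicate of `fermatCMType` (no enumeration of `H`),
this conjunct may be inserted before the closure condition, and the census statement without it follows. [folklore]
[cite: BauerCosteItzyksonRuelle1997, §3.4] -/
theorem not_exists_primitive_group_triple_of_sq
    (K : ¬∃ r s : ZMod n, r ≠ 0 ∧ s ≠ 0 ∧ r.val + s.val < n ∧ Nat.gcd (Nat.gcd r.val s.val) n = 1 ∧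
      (∀ h : ZMod n, (h.val.Coprime n ∧ (h * r).val + (h * s).val + (h * (-(r + s))).val = n) →
        ((h * h).val.Coprime n ∧ (h * h * r).val + (h * h * s).val + (h * h * (-(r + s))).val = n)) ∧
      ∀ a ∈ fermatCMType n r s (-(r + s)), ∀ b ∈ fermatCMType n r s (-(r + s)), a * b ∈ fermatCMType n r s (-(r + s))) :
    ¬∃ r s : ZMod n, r ≠ 0 ∧ s ≠ 0 ∧ r.val + s.val < n ∧ Nat.gcd (Nat.gcd r.val s.val) n = 1 ∧
      ∀ a ∈ fermatCMType n r s (-(r + s)), ∀ b ∈ fermatCMType n r s (-(r + s)), a * b ∈ fermatCMType n r s (-(r + s)) := by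
  rintro ⟨r, s, hr, hs, hrs, hp, hcl⟩
  refine K ⟨r, s, hr, hs, hrs, hp, fun h hh => ?_, hcl⟩
  have hm : h ∈ fermatCMType n r s (-(r + s)) := Finset.mem_filter.2 ⟨Finset.mem_univ _, hh⟩
  exact (Finset.mem_filter.1 (hcl h hm h hm)).2

end Filter

/-! ## §1 The levels `41, …, 59` other than `48`: no primitive triple with `H` a group -/

section Levels

/-- **Level `41`**: NO primitive normalised triple `(r, s, −r−s)` modulo `41` has `H_{r,s,t}` closed under multiplication (kernel, all `(r, s)`;
the square test first). [cite: BauerCosteItzyksonRuelle1997, §3.4] -/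
theorem not_exists_primitive_group_triple_fortyOne :
    ¬∃ r s : ZMod 41, r ≠ 0 ∧ s ≠ 0 ∧ r.val + s.val < 41 ∧ Nat.gcd (Nat.gcd r.val s.val) 41 = 1 ∧
      ∀ a ∈ fermatCMType 41 r s (-(r + s)), ∀ b ∈ fermatCMType 41 r s (-(r + s)), a * b ∈ fermatCMType 41 r s (-(r + s)) :=
  not_exists_primitive_group_triple_of_sq (by decide +kernel)

/-- **Level `42`**: NO primitive normalised triple `(r, s, −r−s)` modulo `42` has `H_{r,s,t}` closed under multiplication (kernel, all `(r, s)`;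
the square test first). [cite: BauerCosteItzyksonRuelle1997, §3.4] -/
theorem not_exists_primitive_group_triple_fortyTwo :
    ¬∃ r s : ZMod 42, r ≠ 0 ∧ s ≠ 0 ∧ r.val + s.val < 42 ∧ Nat.gcd (Nat.gcd r.val s.val) 42 = 1 ∧
      ∀ a ∈ fermatCMType 42 r s (-(r + s)), ∀ b ∈ fermatCMType 42 r s (-(r + s)), a * b ∈ fermatCMType 42 r s (-(r + s)) :=
  not_exists_primitive_group_triple_of_sq (by decide +kernel)

/-- **Level `43`**: NO primitive normalised triple `(r, s, −r−s)` modulo `43` has `H_{r,s,t}` closed under multiplication (kernel, all `(r, s)`;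
the square test first). [cite: BauerCosteItzyksonRuelle1997, §3.4] -/
theorem not_exists_primitive_group_triple_fortyThree :
    ¬∃ r s : ZMod 43, r ≠ 0 ∧ s ≠ 0 ∧ r.val + s.val < 43 ∧ Nat.gcd (Nat.gcd r.val s.val) 43 = 1 ∧
      ∀ a ∈ fermatCMType 43 r s (-(r + s)), ∀ b ∈ fermatCMType 43 r s (-(r + s)), a * b ∈ fermatCMType 43 r s (-(r + s)) :=
  not_exists_primitive_group_triple_of_sq (by decide +kernel)

/-- **Level `44`**: NO primitive normalised triple `(r, s, −r−s)` modulo `44` has `H_{r,s,t}` closed under multiplication (kernel, all `(r, s)`;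
the square test first). [cite: BauerCosteItzyksonRuelle1997, §3.4] -/
theorem not_exists_primitive_group_triple_fortyFour :
    ¬∃ r s : ZMod 44, r ≠ 0 ∧ s ≠ 0 ∧ r.val + s.val < 44 ∧ Nat.gcd (Nat.gcd r.val s.val) 44 = 1 ∧
      ∀ a ∈ fermatCMType 44 r s (-(r + s)), ∀ b ∈ fermatCMType 44 r s (-(r + s)), a * b ∈ fermatCMType 44 r s (-(r + s)) :=
  not_exists_primitive_group_triple_of_sq (by decide +kernel)

/-- **Level `45`**: NO primitive normalised triple `(r, s, −r−s)` modulo `45` has `H_{r,s,t}` closed under multiplication (kernel, all `(r, s)`;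
the square test first). [cite: BauerCosteItzyksonRuelle1997, §3.4] -/
theorem not_exists_primitive_group_triple_fortyFive :
    ¬∃ r s : ZMod 45, r ≠ 0 ∧ s ≠ 0 ∧ r.val + s.val < 45 ∧ Nat.gcd (Nat.gcd r.val s.val) 45 = 1 ∧
      ∀ a ∈ fermatCMType 45 r s (-(r + s)), ∀ b ∈ fermatCMType 45 r s (-(r + s)), a * b ∈ fermatCMType 45 r s (-(r + s)) :=
  not_exists_primitive_group_triple_of_sq (by decide +kernel)

/-- **Level `46`**: NO primitive normalised triple `(r, s, −r−s)` modulo `46` has `H_{r,s,t}` closed under multiplication (kernel, all `(r, s)`;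
the square test first). [cite: BauerCosteItzyksonRuelle1997, §3.4] -/
theorem not_exists_primitive_group_triple_fortySix :
    ¬∃ r s : ZMod 46, r ≠ 0 ∧ s ≠ 0 ∧ r.val + s.val < 46 ∧ Nat.gcd (Nat.gcd r.val s.val) 46 = 1 ∧
      ∀ a ∈ fermatCMType 46 r s (-(r + s)), ∀ b ∈ fermatCMType 46 r s (-(r + s)), a * b ∈ fermatCMType 46 r s (-(r + s)) :=
  not_exists_primitive_group_triple_of_sq (by decide +kernel)

/-- **Level `47`**: NO primitive normalised triple `(r, s, −r−s)` modulo `47` has `H_{r,s,t}` closed under multiplication (kernel, all `(r, s)`;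
the square test first). [cite: BauerCosteItzyksonRuelle1997, §3.4] -/
theorem not_exists_primitive_group_triple_fortySeven :
    ¬∃ r s : ZMod 47, r ≠ 0 ∧ s ≠ 0 ∧ r.val + s.val < 47 ∧ Nat.gcd (Nat.gcd r.val s.val) 47 = 1 ∧
      ∀ a ∈ fermatCMType 47 r s (-(r + s)), ∀ b ∈ fermatCMType 47 r s (-(r + s)), a * b ∈ fermatCMType 47 r s (-(r + s)) :=
  not_exists_primitive_group_triple_of_sq (by decide +kernel)

/-- **Level `49`**: NO primitive normalised triple `(r, s, −r−s)` modulo `49` has `H_{r,s,t}` closed under multiplication (kernel, all `(r, s)`;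
the square test first). [cite: BauerCosteItzyksonRuelle1997, §3.4] -/
theorem not_exists_primitive_group_triple_fortyNine :
    ¬∃ r s : ZMod 49, r ≠ 0 ∧ s ≠ 0 ∧ r.val + s.val < 49 ∧ Nat.gcd (Nat.gcd r.val s.val) 49 = 1 ∧
      ∀ a ∈ fermatCMType 49 r s (-(r + s)), ∀ b ∈ fermatCMType 49 r s (-(r + s)), a * b ∈ fermatCMType 49 r s (-(r + s)) :=
  not_exists_primitive_group_triple_of_sq (by decide +kernel)

/-- **Level `50`**: NO primitive normalised triple `(r, s, −r−s)` modulo `50` has `H_{r,s,t}` closed under multiplication (kernel, all `(r, s)`;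
the square test first). [cite: BauerCosteItzyksonRuelle1997, §3.4] -/
theorem not_exists_primitive_group_triple_fifty :
    ¬∃ r s : ZMod 50, r ≠ 0 ∧ s ≠ 0 ∧ r.val + s.val < 50 ∧ Nat.gcd (Nat.gcd r.val s.val) 50 = 1 ∧
      ∀ a ∈ fermatCMType 50 r s (-(r + s)), ∀ b ∈ fermatCMType 50 r s (-(r + s)), a * b ∈ fermatCMType 50 r s (-(r + s)) :=
  not_exists_primitive_group_triple_of_sq (by decide +kernel)

/-- **Level `51`**: NO primitive normalised triple `(r, s, −r−s)` modulo `51` has `H_{r,s,t}` closed under multiplication (kernel, all `(r, s)`;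
the square test first). [cite: BauerCosteItzyksonRuelle1997, §3.4] -/
theorem not_exists_primitive_group_triple_fiftyOne :
    ¬∃ r s : ZMod 51, r ≠ 0 ∧ s ≠ 0 ∧ r.val + s.val < 51 ∧ Nat.gcd (Nat.gcd r.val s.val) 51 = 1 ∧
      ∀ a ∈ fermatCMType 51 r s (-(r + s)), ∀ b ∈ fermatCMType 51 r s (-(r + s)), a * b ∈ fermatCMType 51 r s (-(r + s)) :=
  not_exists_primitive_group_triple_of_sq (by decide +kernel)

/-- **Level `52`**: NO primitive normalised triple `(r, s, −r−s)` modulo `52` has `H_{r,s,t}` closed under multiplication (kernel, all `(r, s)`;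
the square test first). [cite: BauerCosteItzyksonRuelle1997, §3.4] -/
theorem not_exists_primitive_group_triple_fiftyTwo :
    ¬∃ r s : ZMod 52, r ≠ 0 ∧ s ≠ 0 ∧ r.val + s.val < 52 ∧ Nat.gcd (Nat.gcd r.val s.val) 52 = 1 ∧
      ∀ a ∈ fermatCMType 52 r s (-(r + s)), ∀ b ∈ fermatCMType 52 r s (-(r + s)), a * b ∈ fermatCMType 52 r s (-(r + s)) :=
  not_exists_primitive_group_triple_of_sq (by decide +kernel)

/-- **Level `53`**: NO primitive normalised triple `(r, s, −r−s)` modulo `53` has `H_{r,s,t}` closed under multiplication (kernel, all `(r, s)`;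
the square test first). [cite: BauerCosteItzyksonRuelle1997, §3.4] -/
theorem not_exists_primitive_group_triple_fiftyThree :
    ¬∃ r s : ZMod 53, r ≠ 0 ∧ s ≠ 0 ∧ r.val + s.val < 53 ∧ Nat.gcd (Nat.gcd r.val s.val) 53 = 1 ∧
      ∀ a ∈ fermatCMType 53 r s (-(r + s)), ∀ b ∈ fermatCMType 53 r s (-(r + s)), a * b ∈ fermatCMType 53 r s (-(r + s)) :=
  not_exists_primitive_group_triple_of_sq (by decide +kernel)

/-- **Level `54`**: NO primitive normalised triple `(r, s, −r−s)` modulo `54` has `H_{r,s,t}` closed under multiplication (kernel, all `(r, s)`;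
the square test first). [cite: BauerCosteItzyksonRuelle1997, §3.4] -/
theorem not_exists_primitive_group_triple_fiftyFour :
    ¬∃ r s : ZMod 54, r ≠ 0 ∧ s ≠ 0 ∧ r.val + s.val < 54 ∧ Nat.gcd (Nat.gcd r.val s.val) 54 = 1 ∧
      ∀ a ∈ fermatCMType 54 r s (-(r + s)), ∀ b ∈ fermatCMType 54 r s (-(r + s)), a * b ∈ fermatCMType 54 r s (-(r + s)) :=
  not_exists_primitive_group_triple_of_sq (by decide +kernel)

/-- **Level `55`**: NO primitive normalised triple `(r, s, −r−s)` modulo `55` has `H_{r,s,t}` closed under multiplication (kernel, all `(r, s)`;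
the square test first). [cite: BauerCosteItzyksonRuelle1997, §3.4] -/
theorem not_exists_primitive_group_triple_fiftyFive :
    ¬∃ r s : ZMod 55, r ≠ 0 ∧ s ≠ 0 ∧ r.val + s.val < 55 ∧ Nat.gcd (Nat.gcd r.val s.val) 55 = 1 ∧
      ∀ a ∈ fermatCMType 55 r s (-(r + s)), ∀ b ∈ fermatCMType 55 r s (-(r + s)), a * b ∈ fermatCMType 55 r s (-(r + s)) :=
  not_exists_primitive_group_triple_of_sq (by decide +kernel)

/-- **Level `56`**: NO primitive normalised triple `(r, s, −r−s)` modulo `56` has `H_{r,s,t}` closed under multiplication (kernel, all `(r, s)`;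
the square test first). [cite: BauerCosteItzyksonRuelle1997, §3.4] -/
theorem not_exists_primitive_group_triple_fiftySix :
    ¬∃ r s : ZMod 56, r ≠ 0 ∧ s ≠ 0 ∧ r.val + s.val < 56 ∧ Nat.gcd (Nat.gcd r.val s.val) 56 = 1 ∧
      ∀ a ∈ fermatCMType 56 r s (-(r + s)), ∀ b ∈ fermatCMType 56 r s (-(r + s)), a * b ∈ fermatCMType 56 r s (-(r + s)) :=
  not_exists_primitive_group_triple_of_sq (by decide +kernel)

/-- **Level `57`**: NO primitive normalised triple `(r, s, −r−s)` modulo `57` has `H_{r,s,t}` closed under multiplication (kernel, all `(r, s)`;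
the square test first). [cite: BauerCosteItzyksonRuelle1997, §3.4] -/
theorem not_exists_primitive_group_triple_fiftySeven :
    ¬∃ r s : ZMod 57, r ≠ 0 ∧ s ≠ 0 ∧ r.val + s.val < 57 ∧ Nat.gcd (Nat.gcd r.val s.val) 57 = 1 ∧
      ∀ a ∈ fermatCMType 57 r s (-(r + s)), ∀ b ∈ fermatCMType 57 r s (-(r + s)), a * b ∈ fermatCMType 57 r s (-(r + s)) :=
  not_exists_primitive_group_triple_of_sq (by decide +kernel)

/-- **Level `58`**: NO primitive normalised triple `(r, s, −r−s)` modulo `58` has `H_{r,s,t}` closed under multiplication (kernel, all `(r, s)`;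
the square test first). [cite: BauerCosteItzyksonRuelle1997, §3.4] -/
theorem not_exists_primitive_group_triple_fiftyEight :
    ¬∃ r s : ZMod 58, r ≠ 0 ∧ s ≠ 0 ∧ r.val + s.val < 58 ∧ Nat.gcd (Nat.gcd r.val s.val) 58 = 1 ∧
      ∀ a ∈ fermatCMType 58 r s (-(r + s)), ∀ b ∈ fermatCMType 58 r s (-(r + s)), a * b ∈ fermatCMType 58 r s (-(r + s)) :=
  not_exists_primitive_group_triple_of_sq (by decide +kernel)

/-- **Level `59`**: NO primitive normalised triple `(r, s, −r−s)` modulo `59` has `H_{r,s,t}` closed under multiplication (kernel, all `(r, s)`;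
the square test first). [cite: BauerCosteItzyksonRuelle1997, §3.4] -/
theorem not_exists_primitive_group_triple_fiftyNine :
    ¬∃ r s : ZMod 59, r ≠ 0 ∧ s ≠ 0 ∧ r.val + s.val < 59 ∧ Nat.gcd (Nat.gcd r.val s.val) 59 = 1 ∧
      ∀ a ∈ fermatCMType 59 r s (-(r + s)), ∀ b ∈ fermatCMType 59 r s (-(r + s)), a * b ∈ fermatCMType 59 r s (-(r + s)) :=
  not_exists_primitive_group_triple_of_sq (by decide +kernel)

end Levels

/-! ## §2 The census `3 ≤ n ≤ 60`: exactly the printed set -/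

section Census

/-- **THE KERNEL CENSUS FOR `3 ≤ n ≤ 60` — THE PRINTED SET.**  A primitive normalised triple `(r, s, −r−s)` modulo `n` with `H_{r,s,t}` closed under
multiplication exists iff `n ∈ {3, 4, 6, 7, 8, 12, 15, 16, 18, 20, 21, 22, 24, 30, 39, 40, 48, 60}` — Koblitz's list as printed by Bauer–Coste–Itzykson–Ruelle,
verified level by level over its whole range. [cite: BauerCosteItzyksonRuelle1997, §3.4] [cite: KoblitzRohrlich1978, §2 Remark 2 (the levels `21, 39`)] -/
theorem exists_primitive_group_triple_iff_of_le_sixty (n : ℕ) [hnz : NeZero n] (h3 : 3 ≤ n) (h60 : n ≤ 60) :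
    (∃ r s : ZMod n, r ≠ 0 ∧ s ≠ 0 ∧ r.val + s.val < n ∧ Nat.gcd (Nat.gcd r.val s.val) n = 1 ∧
      ∀ a ∈ fermatCMType n r s (-(r + s)), ∀ b ∈ fermatCMType n r s (-(r + s)), a * b ∈ fermatCMType n r s (-(r + s))) ↔
    n ∈ ({3, 4, 6, 7, 8, 12, 15, 16, 18, 20, 21, 22, 24, 30, 39, 40, 48, 60} : Finset ℕ) := by
  by_cases h40 : n ≤ 40
  · rw [exists_primitive_group_triple_iff_of_le_forty n h3 h40]
    simp only [Finset.mem_insert, Finset.mem_singleton]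
    omega
  · have h41 : 41 ≤ n := by omega
    interval_cases n <;> (obtain rfl : hnz = ⟨by decide⟩ := Subsingleton.elim _ _)
    · exact iff_of_false not_exists_primitive_group_triple_fortyOne (by decide)
    · exact iff_of_false not_exists_primitive_group_triple_fortyTwo (by decide)
    · exact iff_of_false not_exists_primitive_group_triple_fortyThree (by decide)
    · exact iff_of_false not_exists_primitive_group_triple_fortyFour (by decide)
    · exact iff_of_false not_exists_primitive_group_triple_fortyFive (by decide)
    · exact iff_of_false not_exists_primitive_group_triple_fortySix (by decide)
    · exact iff_of_false not_exists_primitive_group_triple_fortySeven (by decide)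
    · exact iff_of_true (exists_primitive_group_triple_of_mem_koblitzList (by decide)) (by decide)
    · exact iff_of_false not_exists_primitive_group_triple_fortyNine (by decide)
    · exact iff_of_false not_exists_primitive_group_triple_fifty (by decide)
    · exact iff_of_false not_exists_primitive_group_triple_fiftyOne (by decide)
    · exact iff_of_false not_exists_primitive_group_triple_fiftyTwo (by decide)
    · exact iff_of_false not_exists_primitive_group_triple_fiftyThree (by decide)
    · exact iff_of_false not_exists_primitive_group_triple_fiftyFour (by decide)
    · exact iff_of_false not_exists_primitive_group_triple_fiftyFive (by decide)
    · exact iff_of_false not_exists_primitive_group_triple_fiftySix (by decide)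
    · exact iff_of_false not_exists_primitive_group_triple_fiftySeven (by decide)
    · exact iff_of_false not_exists_primitive_group_triple_fiftyEight (by decide)
    · exact iff_of_false not_exists_primitive_group_triple_fiftyNine (by decide)
    · exact iff_of_true (exists_primitive_group_triple_of_mem_koblitzList (by decide)) (by decide)

variable {n : ℕ} [NeZero n] {L : Type} [Field L] [NumberField L] [IsCyclotomicExtension {n} ℚ L]

/-- **THE CONVERSE UP TO `60`, ON ABELIAN VARIETIES**: if some realisation of some primitive normalised K–R type at a level `3 ≤ n ≤ 60` is isogenous
to a power of an elliptic curve, then `n` is in the printed set `{3, 4, 6, 7, 8, 12, 15, 16, 18, 20, 21, 22, 24, 30, 39, 40, 48, 60}`.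
[cite: BauerCosteItzyksonRuelle1997, §3.4] [cite: KoblitzRohrlich1978, §1 p. 1184] -/
theorem mem_koblitzList_of_exists_isIsogeny_pow_elliptic_of_le_sixty (h3 : 3 ≤ n) (h60 : n ≤ 60) {r s : ZMod n} (hr : r ≠ 0) (hs : s ≠ 0)
    (hrs : r.val + s.val < n) (hprim : Nat.gcd (Nat.gcd r.val s.val) n = 1)
    {hS : ∀ c : ZMod n, c.val.Coprime n → (c ∈ fermatCMType n r s (-(r + s)) ↔ -c ∉ fermatCMType n r s (-(r + s)))}
    {A : AbelianVariety ℂ} {ι : 𝓞 L →+* End A} {θ : L →+* Module.End ℂ (complexBetti A.X 1)}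
    (hA : IsCMTypeRealisation (cmTypeOfResidues (L := L) (fermatCMType n r s (-(r + s))) hS) A ι θ)
    (hE : ∃ (E P : AbelianVariety ℂ) (h : ℕ) (π : Fin h → (P ⟶ E)) (g : A ⟶ P),
      E.dim = 1 ∧ Nonempty (IsLimit (Fan.mk P π)) ∧ IsIsogeny g) :
    n ∈ ({3, 4, 6, 7, 8, 12, 15, 16, 18, 20, 21, 22, 24, 30, 39, 40, 48, 60} : Finset ℕ) := by
  have hn2 : 2 < n := by omega
  haveI : IsCMField L := IsCyclotomicExtension.Rat.isCMField L (S := {n}) ⟨n, rfl, hn2⟩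
  have hcl := (exists_isIsogeny_pow_elliptic_fermat_iff_forall_mul_mem hn2 (one_mem_fermatCMType_of_val_add_lt hr hrs) hA).1 hE
  exact (exists_primitive_group_triple_iff_of_le_sixty n h3 h60).1 ⟨r, s, hr, hs, hrs, hprim, hcl⟩

/-- **Equivalently, for `3 ≤ n ≤ 60`: some realisation of some primitive normalised K–R type at level `n` is isogenous to a power of an elliptic
curve iff `n` is in the printed set** (the forward direction above; the backward one by the witnesses of the prequel, every realisation of which splits).
[cite: BauerCosteItzyksonRuelle1997, §3.4] -/
theorem exists_elliptic_triple_iff_mem_koblitzList_of_le_sixty (h3 : 3 ≤ n) (h60 : n ≤ 60) :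
    (∃ (r s : ZMod n) (hS : ∀ c : ZMod n, c.val.Coprime n → (c ∈ fermatCMType n r s (-(r + s)) ↔ -c ∉ fermatCMType n r s (-(r + s))))
        (A : AbelianVariety ℂ) (ι : 𝓞 L →+* End A) (θ : L →+* Module.End ℂ (complexBetti A.X 1)),
        r ≠ 0 ∧ s ≠ 0 ∧ r.val + s.val < n ∧ Nat.gcd (Nat.gcd r.val s.val) n = 1 ∧
        IsCMTypeRealisation (cmTypeOfResidues (L := L) (fermatCMType n r s (-(r + s))) hS) A ι θ ∧
        ∃ (E P : AbelianVariety ℂ) (h : ℕ) (π : Fin h → (P ⟶ E)) (g : A ⟶ P), E.dim = 1 ∧ Nonempty (IsLimit (Fan.mk P π)) ∧ IsIsogeny g) ↔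
    n ∈ ({3, 4, 6, 7, 8, 12, 15, 16, 18, 20, 21, 22, 24, 30, 39, 40, 48, 60} : Finset ℕ) := by
  constructor
  · rintro ⟨r, s, hS, A, ι, θ, hr, hs, hrs, hprim, hA, hE⟩
    exact mem_koblitzList_of_exists_isIsogeny_pow_elliptic_of_le_sixty h3 h60 hr hs hrs hprim hA hE
  · intro hn
    obtain ⟨r, s, hS, hr, hs, hrs, hprim, ⟨A, ι, θ, hA⟩, hall⟩ := exists_elliptic_triple_of_mem_koblitzList (L := L) hn
    exact ⟨r, s, hS, A, ι, θ, hr, hs, hrs, hprim, hA, hall A ι θ hA⟩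

end Census

end CyclotomicFermatCMType

end Literature.AlgebraicGeometry.ComplexMultiplication
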